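import Mathlib

/-!
# Sketch — first lemmas of the three crux-idea cards for `UnitCircleCrossedOnce`
(crux stmt-RiemannHypothesis-1470, route MayerPairing). Statements only (`def … : Prop`);
they must elaborate, they need not be proved here.
-/

namespace Summit.RiemannHypothesis.RiemannHypothesis.Cruxes.UnitCircleCrossedOnce.Sketch

open scoped Real

/-! ## Card `zeta-coupling-rank-one` -/

/-- The ζ-free part `B_s f (x) = Σ_{n≥1} [(x+n)^{-2s} f(1/(x+n)) − n^{-2s} f(0)]` of Mayer's
operator converges absolutely on the WHOLE half-plane `0 < Re s` (no analytic continuation), for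
`f` Lipschitz at the cusp `0` on the closed unit disc; here on the real axis `x ≥ 0`. -/
def BsSummable : Prop :=
  ∀ s : ℂ, 0 < s.re → ∀ f : ℂ → ℂ, (∃ C : ℝ, ∀ w : ℂ, ‖w‖ ≤ 1 → ‖f w - f 0‖ ≤ C * ‖w‖) →
    ∀ x : ℝ, 0 ≤ x →
      Summable (fun n : ℕ => ((x : ℂ) + (n + 1)) ^ (-(2 * s)) * f (1 / ((x : ℂ) + (n + 1)))
        - ((n : ℂ) + 1) ^ (-(2 * s)) * f 0)

/-- The cusp splitting `L_s = B_s + ζ(2s)·P_0` (`P_0 f = f(0)·1`) in the convergent range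
`1/2 < Re s`, written on the real axis with Mathlib's Hurwitz zeta (`Σ_{n≥1}(x+n)^{-2s} =
ζ(2s,x) − x^{-2s}` for `0 ≤ x ≤ 1`; at `x = 0` Mathlib's conventions give `ζ(2s)`): the only
ζ-carrying term is the rank-one `f(0)·ζ(2s, x+1)`, and `ζ(2s, x+1) − ζ(2s)` is again ζ-free. -/
def CuspSplitting : Prop :=
  ∀ s : ℂ, 1 / 2 < s.re → ∀ f : ℂ → ℂ, (∃ C : ℝ, ∀ w : ℂ, ‖w‖ ≤ 1 → ‖f w - f 0‖ ≤ C * ‖w‖) →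
    ∀ x : ℝ, 0 ≤ x → x ≤ 1 →
      ∑' n : ℕ, ((x : ℂ) + (n + 1)) ^ (-(2 * s)) * f (1 / ((x : ℂ) + (n + 1)))
        = (∑' n : ℕ, (((x : ℂ) + (n + 1)) ^ (-(2 * s)) * f (1 / ((x : ℂ) + (n + 1)))
            - ((n : ℂ) + 1) ^ (-(2 * s)) * f 0))
          + f 0 * (HurwitzZeta.hurwitzZeta (x : UnitAddCircle) (2 * s) - (x : ℂ) ^ (-(2 * s)))

/-- Slope law at a simple eigenvalue of a rank-one-coupled family (finite-dimensional shadow, the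
form in which the card's `dλ/dσ = ∂_sΛ + 2ζ'(2s)∂_κΛ` is first checked): for matrices
`M(κ) = B + κ • P` with `P = v wᵀ` rank one, a right/left eigenpair gives the κ-derivative
`(yᵀ P x)/(yᵀ x) = (yᵀ v)(wᵀ x)/(yᵀ x)`. Stated as the Hellmann–Feynman identity for the linear
pencil. -/
def RankOneSlope : Prop :=
  ∀ (n : ℕ) (B : Matrix (Fin n) (Fin n) ℂ) (v w x y : Fin n → ℂ) (κ lam dlam : ℂ)
    (x' : Fin n → ℂ),
    -- eigen-equations at κ and their κ-derivative (x' = dx/dκ, dlam = dλ/dκ)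
    (B + κ • Matrix.vecMulVec v w).mulVec x = lam • x →
    Matrix.vecMul y (B + κ • Matrix.vecMulVec v w) = lam • y →
    (Matrix.vecMulVec v w).mulVec x + (B + κ • Matrix.vecMulVec v w).mulVec x'
        = dlam • x + lam • x' →
    dlam * (y ⬝ᵥ x) = (y ⬝ᵥ v) * (w ⬝ᵥ x)

/-! ## Card `gamma-unitarised-hankel-involution` -/

/-- Bose–Mellin finite part = Hurwitz continuation: in the critical strip `0 < Re w < 1` of the
weight variable the regularised (cusp-subtracted) Bose integral IS `Γ(w) ζ(w, a)` — the identity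
that carries Mayer's Laplace/Bessel model of `L_s` into `0 < Re s < 1/2` (`w = 2s`) as an honest
convergent integral (Hadamard finite part of `∫ t^{w-1} e^{-at}/(1-e^{-t}) dt`). -/
def BoseMellinFinitePart : Prop :=
  ∀ w : ℂ, 0 < w.re → w.re < 1 → ∀ a : ℝ, 0 < a → a ≤ 1 →
    ∫ t in Set.Ioi (0 : ℝ), (t : ℂ) ^ (w - 1) *
        (((Real.exp (-(a * t)) / (1 - Real.exp (-t)) - 1 / t : ℝ) : ℂ))
      = Complex.Gamma w * HurwitzZeta.hurwitzZeta (a : UnitAddCircle) w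

/-- The Mellin symbol `m_ν(w) = Γ(ν/2 + w)/Γ(ν/2 + 1 − w)` of the Hankel-type transform
`𝒯_ν χ(t) = ∫₀^∞ J_ν(2√(ut)) χ(u) du` (the Weyl element in the Kirillov model of weight `ν+1 = 2s`)
satisfies the involution identity `m_ν(w) m_ν(1−w) = 1` — `𝒯_ν² = 1` for every COMPLEX order. -/
def HankelMultiplierInvolution : Prop :=
  ∀ ν w : ℂ, (∀ n : ℕ, ν / 2 + w ≠ -(n : ℂ)) → (∀ n : ℕ, ν / 2 + 1 - w ≠ -(n : ℂ)) →
    (Complex.Gamma (ν / 2 + w) / Complex.Gamma (ν / 2 + 1 - w)) *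
      (Complex.Gamma (ν / 2 + (1 - w)) / Complex.Gamma (ν / 2 + 1 - (1 - w))) = 1

/-- The Γ-weight that unitarises `𝒯_ν` for complex `ν = 2s − 1`: on the unitary Mellin line
`w = 1/2 + iξ` one has `𝒯_ν 𝒯_ν̄ = G(D)` with `G(w) = m_ν(w)·m_ν̄(1−w) = |Γ(s+iξ)|²/|Γ(s−iξ)|²`
and `G(1−w) = 1/G(w)`; the two scalar facts used are stated in the concrete form:
`Π_s(ξ) := ‖Γ(s − iξ)‖/‖Γ(s + iξ)‖` satisfies `Π_s(ξ) · Π_s(−ξ) = 1` and `0 < Π_s(ξ)`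
(for `s` off the poles), which is what makes `⟨Π_s(D)·,·⟩` an inner product in which the
involution `𝒯_{2s-1}` is self-adjoint and unitary, whence `|λ| = ‖bφ‖_Π/‖φ‖_Π` for every
eigenpair `L_s φ = λ φ` (`b = 1/(eᵘ−1)`). -/
def GammaWeightReflection : Prop :=
  ∀ s : ℂ, 0 < s.re → ∀ ξ : ℝ,
    0 < ‖Complex.Gamma (s - ξ * Complex.I)‖ / ‖Complex.Gamma (s + ξ * Complex.I)‖ ∧
    (‖Complex.Gamma (s - ξ * Complex.I)‖ / ‖Complex.Gamma (s + ξ * Complex.I)‖) *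
      (‖Complex.Gamma (s - (-ξ) * Complex.I)‖ / ‖Complex.Gamma (s + (-ξ) * Complex.I)‖) = 1

/-! ## Card `ep-free-maximum-principle` -/

/-- Phragmén–Lindelöf on an upper half-strip `{a < Re z < b, T < Im z}`: a function of
double-exponential growth strictly below the critical rate `π/(b−a)` that is bounded by `1` on the
two vertical edges and on the bottom edge is bounded by `1` inside. Applied to
`F = exp(λ_k'/λ_k)` on an exceptional-point-free, zero-free domain of an eigenvalue branch,
it turns the harmonic slope `Re(λ_k'/λ_k)` negative inside from boundary data alone. -/
def HalfStripPhragmenLindelof : Prop :=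
  ∀ (F : ℂ → ℂ) (a b T : ℝ), a < b →
    DiffContOnCl ℂ F {z : ℂ | a < z.re ∧ z.re < b ∧ T < z.im} →
    (∃ c : ℝ, c < Real.pi / (b - a) ∧ ∃ B : ℝ, ∀ z : ℂ, a ≤ z.re → z.re ≤ b → T ≤ z.im →
        ‖F z‖ ≤ Real.exp (B * Real.exp (c * z.im))) →
    (∀ z : ℂ, (z.re = a ∨ z.re = b) → T ≤ z.im → ‖F z‖ ≤ 1) →
    (∀ z : ℂ, a ≤ z.re → z.re ≤ b → z.im = T → ‖F z‖ ≤ 1) →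
    ∀ z : ℂ, a ≤ z.re → z.re ≤ b → T ≤ z.im → ‖F z‖ ≤ 1

/-- The slope-sign corollary in the form the line uses it: a zero-free holomorphic `g` (one
eigenvalue branch `λ_k`, single-valued because the closed half-strip is free of exceptional points)
whose logarithmic derivative has non-positive real part on the three edges and sub-critical growth
has `Re(g'/g) ≤ 0` throughout — i.e. `|g(σ+iτ)|` is non-increasing in `σ` on every horizontal
segment of the half-strip. -/
def SlopeSignByMaximumPrinciple : Prop :=
  ∀ (g : ℂ → ℂ) (a b T : ℝ), a < b →
    DifferentiableOn ℂ g {z : ℂ | a - 1 < z.re ∧ z.re < b + 1 ∧ T - 1 < z.im} →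
    (∀ z : ℂ, a - 1 < z.re → z.re < b + 1 → T - 1 < z.im → g z ≠ 0) →
    (∃ c : ℝ, c < Real.pi / (b - a) ∧ ∃ B : ℝ, ∀ z : ℂ, a ≤ z.re → z.re ≤ b → T ≤ z.im →
        (deriv g z / g z).re ≤ B * Real.exp (c * z.im)) →
    (∀ z : ℂ, (z.re = a ∨ z.re = b) → T ≤ z.im → (deriv g z / g z).re ≤ 0) →
    (∀ z : ℂ, a ≤ z.re → z.re ≤ b → z.im = T → (deriv g z / g z).re ≤ 0) →
    ∀ z : ℂ, a ≤ z.re → z.re ≤ b → T ≤ z.im → (deriv g z / g z).re ≤ 0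

end Summit.RiemannHypothesis.RiemannHypothesis.Cruxes.UnitCircleCrossedOnce.Sketch
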